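import Mathlib.Data.Real.Basic
import Mathlib.Tactic.Linarith
import Mathlib.Tactic.NormNum
import HarnessLib

/-!
# The recorded web of inequalities does not decide the diamond cut (independence models)

Support note for `stmt-MatrixMultiplication-33477` of route `TetrahedronCarving` (lineage
`decomp-mm-lens-6`, generation 20), companion of `EdgePencilExponent`.

The tree records, between `ω` (matrix multiplication), `ψ₁ = ψ(1)` (the diamond `K₄ - e`,
`EdgePencilExponent.omegaPencil _ 1`) and `ω(K₄)` (`omegaTetra`), exactly the following inequalities:
`2 ≤ ω` (flattening), `4 ≤ ψ₁` (grouping + information bound), `ψ₁ ≤ ω + 2` (triangle × cherry cover),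
`ψ₁ ≤ ω(K₄)` (restriction), `ω(K₄) ≤ 2ω` (square-level triangle cover), `4 ≤ ω(K₄)`, and the shadow
`ψ₁ ≤ 4 → ω ≤ 12/5` (Lotti–Romani). A `DiamondWeb` is a real triple satisfying them. We exhibit webs
showing that NEITHER conjunct of the diamond cut `ω = 2 ⟺ (ψ₁ ≤ 4 ∧ ω + 2 ≤ ψ₁)` is decided by the
record (each holds in one web with `ω > 2` and fails in another), in contrast with the
flattening-priced residual `2ω ≤ ψ₁`, which the record reduces to `ω = 2` (`EdgePencilExponent.
two_mul_omega_le_omegaPencil_one_iff`; here: `DiamondWeb.omega_eq_two_of_two_mul_le`). This is the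
exponent-web bookkeeping of NODE-g18 §5 (`K4Web`) for the re-priced residual. [folklore]
-/

set_option linter.dupNamespace false

namespace Summit.MatrixMultiplication.MatrixMultiplication.Theorems.EdgePencil

/-- A model of the recorded inequalities between `ω`, `ψ(1)` and `ω(K₄)`. -/
structure DiamondWeb where
  /-- stands for `ω` -/
  om : ℝ
  /-- stands for `ψ(1)`, the diamond exponent -/
  psi : ℝ
  /-- stands for `ω(K₄)` -/
  tet : ℝ
  two_le_om : 2 ≤ om
  four_le_psi : 4 ≤ psi
  psi_le_cover : psi ≤ om + 2
  psi_le_tet : psi ≤ tet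
  tet_le_two_mul : tet ≤ 2 * om
  shadow : psi ≤ 4 → om ≤ 12 / 5

namespace DiamondWeb

/-- In every web the flattening-priced diamond residual `2ω ≤ ψ₁` forces `ω = 2` (a costume). -/
theorem omega_eq_two_of_two_mul_le (W : DiamondWeb) (h : 2 * W.om ≤ W.psi) : W.om = 2 := by
  have := W.psi_le_cover
  have := W.two_le_om
  linarith

/-- In every web the diamond cut decides `ω = 2`: `(ψ₁ ≤ 4 ∧ ω + 2 ≤ ψ₁) → ω = 2`. -/
theorem omega_eq_two_of_cut (W : DiamondWeb) (h : W.psi ≤ 4 ∧ W.om + 2 ≤ W.psi) : W.om = 2 := by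
  have := W.two_le_om
  linarith [h.1, h.2]

/-- A web at the record values `ω = 2.37`, in which the cover-priced residual `ω + 2 ≤ ψ₁` HOLDS
(`ψ₁ = 4.37 = ω + 2`, `ω(K₄) = 2ω`) although `ω > 2`. -/
def residualHolds : DiamondWeb where
  om := 2.37
  psi := 4.37
  tet := 4.74
  two_le_om := by norm_num
  four_le_psi := by norm_num
  psi_le_cover := by norm_num
  psi_le_tet := by norm_num
  tet_le_two_mul := by norm_num
  shadow := by norm_num

/-- A web at `ω = 2.37` in which the cover-priced residual FAILS (`ψ₁ = 4.2 < ω + 2`). -/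
def residualFails : DiamondWeb where
  om := 2.37
  psi := 4.2
  tet := 4.74
  two_le_om := by norm_num
  four_le_psi := by norm_num
  psi_le_cover := by norm_num
  psi_le_tet := by norm_num
  tet_le_two_mul := by norm_num
  shadow := by norm_num

/-- A web in which the diamond is FLAT (`ψ₁ = 4`) although `ω = 2.3 > 2` (and `ω(K₄) = 4`: even
`TetraFlat` holds there). -/
def flatHolds : DiamondWeb where
  om := 2.3
  psi := 4
  tet := 4
  two_le_om := by norm_num
  four_le_psi := by norm_num
  psi_le_cover := by norm_num
  psi_le_tet := by norm_num
  tet_le_two_mul := by norm_num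
  shadow := by norm_num

/-- **The record does not decide the cover-priced residual**: it holds in one web with `ω ≠ 2` and
fails in another. -/
theorem residual_undecided :
    (residualHolds.om + 2 ≤ residualHolds.psi ∧ residualHolds.om ≠ 2) ∧
      ¬ (residualFails.om + 2 ≤ residualFails.psi) := by
  refine ⟨⟨by norm_num [residualHolds], by norm_num [residualHolds]⟩, by norm_num [residualFails]⟩

/-- **The record does not decide diamond flatness**: `ψ₁ ≤ 4` holds in a web with `ω ≠ 2` and fails
in another. -/
theorem flat_undecided :
    (flatHolds.psi ≤ 4 ∧ flatHolds.om ≠ 2) ∧ ¬ (residualHolds.psi ≤ 4) := by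
  refine ⟨⟨by norm_num [flatHolds], by norm_num [flatHolds]⟩, by norm_num [residualHolds]⟩

/-- In the flat web the residual fails and in the residual web flatness fails: the two conjuncts of
the cut are independent of each other over the record, and neither alone gives `ω = 2`. -/
theorem conjuncts_independent :
    (flatHolds.psi ≤ 4 ∧ ¬ (flatHolds.om + 2 ≤ flatHolds.psi)) ∧
      (residualHolds.om + 2 ≤ residualHolds.psi ∧ ¬ (residualHolds.psi ≤ 4)) := by
  refine ⟨⟨by norm_num [flatHolds], by norm_num [flatHolds]⟩,
    ⟨by norm_num [residualHolds], by norm_num [residualHolds]⟩⟩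

end DiamondWeb

end Summit.MatrixMultiplication.MatrixMultiplication.Theorems.EdgePencil
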